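import Mathlib
import Summits.NavierStokesRegularity.NavierStokesRegularity.Theorems.EulerZoomLiouvillePowerGaugeEulerLiouvilleSelfSimilarPressureSlaving
import HarnessLib

/-!
# Crux E `PowerGaugeEulerLiouville` (stmt-NavierStokesRegularity-19832): DSS PRESSURE SLAVING, step 1 — the pressure of a
# DISCRETELY self-similar member of Seregin's class is a.e. discretely self-similar (one-scale covariance)

Route №10 `EulerZoomLiouville` (NavierStokesRegularity), crux E.  The census' DSS strata (`IsDSSPowerSpread`, …) carry a VELOCITY clause
`u τ y = l^{1+ρ} u(l^{2+ρ} τ, l y)` AND a PRESSURE clause `p τ y = l^{2(1+ρ)} p(l^{2+ρ} τ, l y)` (all `τ < 0`).  The discrete-group twin of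
ns-ezl-w3 g2's `…SelfSimilarPressureSlaving` (continuous group, exactly self-similar velocities): the ONE rescaling
`(α, β, γ) = (l^{1+ρ}, l^{2+ρ}, l)` fixes a DSS velocity, so
* `DSSPressureSlaving.dss_smul_stPull_apply`, `…isDistributional_dssPressure` — `(u, p_l)`, `p_l(s,y) = l^{2(1+ρ)} p(l^{2+ρ}s, l y)`, is again a
  distributional Euler solution with the same velocity (tree `IsDistributionalNSSolutionOn.stRescale`);
* `DSSPressureSlaving.ae_eq_dssPressure` — with the `D`-type growth `∫∫_{Q_a(0)}|p|^{3/2} ≤ K a^m` (`m < 3`): `p = p_l` A.E. ON THE SLAB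
  (`p − p_l` is a function of time a.e. — `PressureSlaving.setIntegral_sub_mul_divergence_eq_zero` + Rusin–Šverák — and the growth kills it,
  `PressureSlaving.ae_eq_zero_of_ae_const_of_cylinderGrowth`; the body is ns-ezl-w3 g2's `PressureSlaving.ae_eq_rescaledPressure`, verbatim but
  for the scale).
Step 2 (`…DSSPressureSlavingMember`): an EXACTLY DSS representative `p̃ = p` a.e. and the member form `InClass ρ u p H c → InClass ρ u p̃ H c`.

WHAT THIS IS NOT: not NS, not E — a de-conditioning lemma for the census of the crux CLASS 19832 (deletes the pressure clause of DSS strata;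
excludes nothing by itself); `--supports` stmt-19832. [folklore; RusinSverak2011 §2 p. 4; CaffarelliKohnNirenberg1982 §2 (scaling covariance)]
-/

noncomputable section

-- flat `Theorems/<Route><Decl>…` files of one crux share the namespace of the crux (tree convention)
set_option linter.dupNamespace false

open MeasureTheory Set Filter Topology Metric Function TopologicalSpace
open scoped ENNReal NNReal

namespace Summit.NavierStokesRegularity.NavierStokesRegularity.Theorems.PowerGaugeEulerLiouville

open Literature.Analysis Literature.Analysis.FunctionSpaces Literature.Analysis.FluidPDE PressureSlaving

namespace DSSPressureSlaving

/-- **The rescaling `(α, β, γ) = (l^{1+ρ}, l^{2+ρ}, l)` fixes a DSS velocity of factor `l`** (pointwise on the slab):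
`l^{1+ρ} u(l^{2+ρ} s, l y) = u(s, y)` for `s < 0`. [folklore] -/
theorem dss_smul_stPull_apply {ρ l : ℝ}
    {u : ℝ → EuclideanSpace ℝ (Fin 3) → EuclideanSpace ℝ (Fin 3)}
    (hu : ∀ τ : ℝ, τ < 0 → ∀ y, u τ y = (l ^ (1 + ρ)) • u ((l ^ (2 + ρ)) * τ) (l • y)) {s : ℝ} (hs : s < 0)
    (y : EuclideanSpace ℝ (Fin 3)) :
    ((l ^ (1 + ρ)) • stPull (l ^ (2 + ρ)) l 0 (0 : EuclideanSpace ℝ (Fin 3)) u) s y = u s y := by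
  rw [smul_stPull_apply, zero_add, zero_add]
  exact (hu s hs y).symm

/-- **COVARIANCE (one scale).**  If `(u, p)` is a distributional Euler solution (no force) on the slab `(−∞,0) × ℝ³` and `u` is DSS with
factor `l > 1`, then `(u, p_l)`, `p_l = (l^{1+ρ})² • stPull (l^{2+ρ}) l 0 0 p` (i.e. `p_l(s, y) = l^{2(1+ρ)} p(l^{2+ρ} s, l y)`), is a distributional
Euler solution on the slab with the SAME velocity. [cite: CaffarelliKohnNirenberg1982, §2] -/
theorem isDistributional_dssPressure {ρ l : ℝ} (hl : 1 < l)
    {u : ℝ → EuclideanSpace ℝ (Fin 3) → EuclideanSpace ℝ (Fin 3)} {p : ℝ → EuclideanSpace ℝ (Fin 3) → ℝ}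
    (hdist : IsDistributionalNSSolutionOn (slab (EuclideanSpace ℝ (Fin 3)) (Iio 0) isOpen_Iio) 0 0 u p)
    (hu : ∀ τ : ℝ, τ < 0 → ∀ y, u τ y = (l ^ (1 + ρ)) • u ((l ^ (2 + ρ)) * τ) (l • y)) :
    IsDistributionalNSSolutionOn (slab (EuclideanSpace ℝ (Fin 3)) (Iio 0) isOpen_Iio) 0 0 u
      ((l ^ (1 + ρ)) ^ 2 • stPull (l ^ (2 + ρ)) l 0 (0 : EuclideanSpace ℝ (Fin 3)) p) := by
  have hl0 : 0 < l := by linarith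
  have hα : 0 < l ^ (1 + ρ) := Real.rpow_pos_of_pos hl0 _
  have hβ : 0 < l ^ (2 + ρ) := Real.rpow_pos_of_pos hl0 _
  have hβeq : l ^ (2 + ρ) = l ^ (1 + ρ) * l := by
    rw [← Real.rpow_add_one hl0.ne']; ring_nf
  have h := hdist.stRescale hα hl0 hβeq 0 (0 : EuclideanSpace ℝ (Fin 3))
  rw [stPreimage_slab hβ, mul_zero, zero_div] at h
  have h0 : ((l ^ (1 + ρ)) ^ 2 * l) • stPull (l ^ (2 + ρ)) l 0 (0 : EuclideanSpace ℝ (Fin 3))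
      (0 : ℝ → EuclideanSpace ℝ (Fin 3) → EuclideanSpace ℝ (Fin 3)) = 0 := by
    funext s y
    rw [smul_stPull_apply]
    simp
  rw [h0] at h
  refine h.congr_ae ?_ (ae_of_all _ fun _ => rfl)
  rw [coe_slab]
  filter_upwards [ae_restrict_mem (measurableSet_Iio.prod MeasurableSet.univ)] with z hz
  exact dss_smul_stPull_apply hu (mem_prod.1 hz).1 z.2

/-- **`p = p_l` A.E. ON THE SLAB** for a DSS velocity: under the hypotheses of `isDistributional_dssPressure` and the `D`-type growth
`∫∫_{Q_a(0)} |p|^{3/2} ≤ K a^m` for `a ≥ a₀` (`K < ∞`, `m < 3`): `p(s, y) = l^{2(1+ρ)} p(l^{2+ρ} s, l y)` for a.e. `(s, y)` in the slab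
(adapted from ns-ezl-w3 g2's `PressureSlaving.ae_eq_rescaledPressure`, `…SelfSimilarPressureSlaving`). [folklore; RusinSverak2011 §2 p. 4] -/
theorem ae_eq_dssPressure {ρ l : ℝ} (hl : 1 < l)
    {u : ℝ → EuclideanSpace ℝ (Fin 3) → EuclideanSpace ℝ (Fin 3)} {p : ℝ → EuclideanSpace ℝ (Fin 3) → ℝ}
    (hdist : IsDistributionalNSSolutionOn (slab (EuclideanSpace ℝ (Fin 3)) (Iio 0) isOpen_Iio) 0 0 u p)
    {K : ℝ≥0∞} (hK : K ≠ ⊤) {m a₀ : ℝ} (hm : m < 3)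
    (hD : ∀ a : ℝ, a₀ ≤ a →
      ∫⁻ z in parabolicCylinder a (0 : ℝ × EuclideanSpace ℝ (Fin 3)), ‖p z.1 z.2‖ₑ ^ (3 / 2 : ℝ) ≤ K * ENNReal.ofReal (a ^ m))
    (hu : ∀ τ : ℝ, τ < 0 → ∀ y, u τ y = (l ^ (1 + ρ)) • u ((l ^ (2 + ρ)) * τ) (l • y)) :
    ∀ᵐ z ∂(volume.restrict (Iio (0 : ℝ) ×ˢ (univ : Set (EuclideanSpace ℝ (Fin 3))))),
      p z.1 z.2 = (l ^ (1 + ρ)) ^ 2 * p (l ^ (2 + ρ) * z.1) (l • z.2) := by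
  have hl0 : 0 < l := by linarith
  set β : ℝ := l ^ (2 + ρ) with hβdef
  have hβ : 0 < β := Real.rpow_pos_of_pos hl0 _
  set γ : ℝ := l with hγdef
  have hγ : 0 < γ := hl0
  set q : ℝ → EuclideanSpace ℝ (Fin 3) → ℝ := (l ^ (1 + ρ)) ^ 2 • stPull β γ 0 (0 : EuclideanSpace ℝ (Fin 3)) p with hqdef
  have hq : IsDistributionalNSSolutionOn (slab (EuclideanSpace ℝ (Fin 3)) (Iio 0) isOpen_Iio) 0 0 u q :=
    isDistributional_dssPressure hl hdist hu
  set F : ℝ → EuclideanSpace ℝ (Fin 3) → ℝ := fun t x => p t x - q t x with hFdef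
  suffices hF0 : ∀ᵐ z ∂(volume.restrict (Iio (0 : ℝ) ×ˢ (univ : Set (EuclideanSpace ℝ (Fin 3))))), F z.1 z.2 = 0 by
    filter_upwards [hF0] with z hz
    have e : p z.1 z.2 = q z.1 z.2 := sub_eq_zero.1 hz
    rw [e, hqdef, smul_stPull_apply, zero_add, zero_add, smul_eq_mul]
  -- ### measurability
  have hpl : LocallyIntegrableOn (uncurry p) (Iio (0 : ℝ) ×ˢ (univ : Set (EuclideanSpace ℝ (Fin 3)))) volume := by
    have h := hdist.2.2.1; rwa [coe_slab] at h
  have hql : LocallyIntegrableOn (uncurry q) (Iio (0 : ℝ) ×ˢ (univ : Set (EuclideanSpace ℝ (Fin 3)))) volume := by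
    have h := hq.2.2.1; rwa [coe_slab] at h
  have hFl : LocallyIntegrableOn (uncurry F) (Iio (0 : ℝ) ×ˢ (univ : Set (EuclideanSpace ℝ (Fin 3)))) volume :=
    hpl.sub hql
  have hFm : AEStronglyMeasurable (uncurry F)
      (volume.restrict (Iio (0 : ℝ) ×ˢ (univ : Set (EuclideanSpace ℝ (Fin 3))))) := hFl.aestronglyMeasurable
  -- ### `F` is a function of time a.e. (two pressures of one velocity, on each slab `(T₁, 0) × ℝ³`)
  have hconstT : ∀ T₁ : ℝ, ∀ᵐ t ∂(volume.restrict (Ioo T₁ 0)), ∃ κ : ℝ,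
      ∀ᵐ x ∂(volume : Measure (EuclideanSpace ℝ (Fin 3))), F t x = κ := by
    intro T₁
    have hle : slab (EuclideanSpace ℝ (Fin 3)) (Ioo T₁ 0) isOpen_Ioo ≤
        slab (EuclideanSpace ℝ (Fin 3)) (Iio 0) isOpen_Iio := slab_mono Ioo_subset_Iio_self
    have hp' := hdist.of_le hle
    have hq' := hq.of_le hle
    refine ae_exists_const_of_forall_integral_mul_divergence_eq_zero (hFl.mono_set (prod_mono Ioo_subset_Iio_self le_rfl)) ?_
    intro ψ hψ
    have h := setIntegral_sub_mul_divergence_eq_zero hp' hq' hψ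
    rwa [coe_slab] at h
  have hconst : ∀ᵐ t ∂(volume.restrict (Iio (0 : ℝ))), ∃ κ : ℝ,
      ∀ᵐ x ∂(volume : Measure (EuclideanSpace ℝ (Fin 3))), F t x = κ := by
    have hcover : Iio (0 : ℝ) ⊆ ⋃ n : ℕ, Ioo (-((n : ℝ) + 1)) 0 := by
      intro t ht
      obtain ⟨n, hn⟩ := exists_nat_gt (-t)
      exact mem_iUnion.2 ⟨n, ⟨by linarith, ht⟩⟩
    exact ae_restrict_of_ae_restrict_of_subset hcover ((ae_restrict_iUnion_iff _ _).2 fun n => hconstT _)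
  -- ### the growth of `F`
  set L : ℝ := β + γ + 1 with hL
  have hL1 : 1 ≤ L := by rw [hL]; linarith [hβ.le, hγ.le]
  set Kβ : ℝ≥0∞ := ‖(l ^ (1 + ρ)) ^ 2‖ₑ ^ (3 / 2 : ℝ) *
    ENNReal.ofReal (β * γ ^ Module.finrank ℝ (EuclideanSpace ℝ (Fin 3)))⁻¹ with hKβ
  have hKβtop : Kβ ≠ ⊤ :=
    ENNReal.mul_ne_top (ENNReal.rpow_ne_top_of_nonneg (by norm_num) enorm_ne_top) ENNReal.ofReal_ne_top
  have hgrowth : ∀ a : ℝ, max a₀ 1 ≤ a →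
      ∫⁻ z in parabolicCylinder a (0 : ℝ × EuclideanSpace ℝ (Fin 3)), ‖F z.1 z.2‖ₑ ^ (3 / 2 : ℝ) ≤
        (2 ^ ((3 / 2 : ℝ) - 1) * (K + Kβ * K * ENNReal.ofReal (L ^ m))) * ENNReal.ofReal (a ^ m) := by
    intro a ha
    have ha₀ : a₀ ≤ a := (le_max_left _ _).trans ha
    have ha1 : 1 ≤ a := (le_max_right _ _).trans ha
    have ha0 : 0 < a := one_pos.trans_le ha1
    -- the bound for `q` by change of variables
    have hqa : ∫⁻ z in parabolicCylinder a (0 : ℝ × EuclideanSpace ℝ (Fin 3)), ‖q z.1 z.2‖ₑ ^ (3 / 2 : ℝ) ≤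
        Kβ * K * ENNReal.ofReal (L ^ m) * ENNReal.ofReal (a ^ m) := by
      have hsub := parabolicCylinder_subset_preimage hβ hγ ha0
      calc ∫⁻ z in parabolicCylinder a (0 : ℝ × EuclideanSpace ℝ (Fin 3)), ‖q z.1 z.2‖ₑ ^ (3 / 2 : ℝ)
          ≤ ∫⁻ z in stAffine β γ 0 (0 : EuclideanSpace ℝ (Fin 3)) ⁻¹'
              parabolicCylinder (L * a) (0 : ℝ × EuclideanSpace ℝ (Fin 3)), ‖q z.1 z.2‖ₑ ^ (3 / 2 : ℝ) :=
            lintegral_mono_set hsub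
        _ = Kβ * ∫⁻ z in parabolicCylinder (L * a) (0 : ℝ × EuclideanSpace ℝ (Fin 3)), ‖p z.1 z.2‖ₑ ^ (3 / 2 : ℝ) := by
            rw [hqdef, setLIntegral_enorm_rpow_stRescale hβ hγ 0 (0 : EuclideanSpace ℝ (Fin 3)) _ p _ (by norm_num), hKβ]
        _ ≤ Kβ * (K * ENNReal.ofReal ((L * a) ^ m)) := by
            gcongr
            exact hD _ (ha₀.trans (by nlinarith))
        _ = Kβ * K * ENNReal.ofReal (L ^ m) * ENNReal.ofReal (a ^ m) := by
            rw [Real.mul_rpow (by linarith) ha0.le, ENNReal.ofReal_mul (Real.rpow_nonneg (by linarith) _)]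
            ring
    have hpa := hD a ha₀
    -- measurability on the cylinder
    have hsubQ : parabolicCylinder a (0 : ℝ × EuclideanSpace ℝ (Fin 3)) ⊆
        Iio (0 : ℝ) ×ˢ (univ : Set (EuclideanSpace ℝ (Fin 3))) := by
      rintro ⟨t, x⟩ hz
      rw [mem_parabolicCylinder] at hz
      exact mem_prod.2 ⟨by simpa using hz.1.2, mem_univ _⟩
    have hpmQ : AEMeasurable (fun z : ℝ × EuclideanSpace ℝ (Fin 3) => ‖p z.1 z.2‖ₑ ^ (3 / 2 : ℝ))
        (volume.restrict (parabolicCylinder a (0 : ℝ × EuclideanSpace ℝ (Fin 3)))) :=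
      ((hpl.aestronglyMeasurable.mono_measure (Measure.restrict_mono hsubQ le_rfl)).aemeasurable.enorm.pow_const _)
    -- assemble
    calc ∫⁻ z in parabolicCylinder a (0 : ℝ × EuclideanSpace ℝ (Fin 3)), ‖F z.1 z.2‖ₑ ^ (3 / 2 : ℝ)
        ≤ ∫⁻ z in parabolicCylinder a (0 : ℝ × EuclideanSpace ℝ (Fin 3)),
            2 ^ ((3 / 2 : ℝ) - 1) * (‖p z.1 z.2‖ₑ ^ (3 / 2 : ℝ) + ‖q z.1 z.2‖ₑ ^ (3 / 2 : ℝ)) := by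
          refine lintegral_mono fun z => ?_
          calc ‖F z.1 z.2‖ₑ ^ (3 / 2 : ℝ) ≤ (‖p z.1 z.2‖ₑ + ‖q z.1 z.2‖ₑ) ^ (3 / 2 : ℝ) := by
                gcongr
                exact enorm_sub_le
            _ ≤ 2 ^ ((3 / 2 : ℝ) - 1) * (‖p z.1 z.2‖ₑ ^ (3 / 2 : ℝ) + ‖q z.1 z.2‖ₑ ^ (3 / 2 : ℝ)) :=
                ENNReal.rpow_add_le_mul_rpow_add_rpow _ _ (by norm_num)
      _ = 2 ^ ((3 / 2 : ℝ) - 1) * ((∫⁻ z in parabolicCylinder a (0 : ℝ × EuclideanSpace ℝ (Fin 3)), ‖p z.1 z.2‖ₑ ^ (3 / 2 : ℝ)) +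
            ∫⁻ z in parabolicCylinder a (0 : ℝ × EuclideanSpace ℝ (Fin 3)), ‖q z.1 z.2‖ₑ ^ (3 / 2 : ℝ)) := by
          rw [lintegral_const_mul' _ _ (ENNReal.rpow_ne_top_of_nonneg (by norm_num) ENNReal.ofNat_ne_top),
            lintegral_add_left' hpmQ]
      _ ≤ 2 ^ ((3 / 2 : ℝ) - 1) * (K * ENNReal.ofReal (a ^ m) + Kβ * K * ENNReal.ofReal (L ^ m) * ENNReal.ofReal (a ^ m)) := by
          gcongr
      _ = (2 ^ ((3 / 2 : ℝ) - 1) * (K + Kβ * K * ENNReal.ofReal (L ^ m))) * ENNReal.ofReal (a ^ m) := by ring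
  -- ### the growth kills `F`
  have hKtot : 2 ^ ((3 / 2 : ℝ) - 1) * (K + Kβ * K * ENNReal.ofReal (L ^ m)) ≠ ⊤ := by
    refine ENNReal.mul_ne_top (ENNReal.rpow_ne_top_of_nonneg (by norm_num) ENNReal.ofNat_ne_top) ?_
    exact ENNReal.add_ne_top.2 ⟨hK, ENNReal.mul_ne_top (ENNReal.mul_ne_top hKβtop hK) ENNReal.ofReal_ne_top⟩
  exact ae_eq_zero_of_ae_const_of_cylinderGrowth (r := 3 / 2) (by norm_num) hFm hconst hKtot hm hgrowth


end DSSPressureSlaving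

end Summit.NavierStokesRegularity.NavierStokesRegularity.Theorems.PowerGaugeEulerLiouville
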